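import Summits.Ventures.WeilGRH.DualTrigKernelSound
import HarnessLib

/-!
# Format D-K: the claimed window values as roots of unity (helper identities for family instances)

Cell `rh-explicit`, WEIL TRACK — GRH ARM, route B (weil-grh-3).  A format-D-K certificate claims the
window values `χ(n) = e^{2πi u/v}` (`DKCert.valZ`); the family instance files state their hypotheses as
`χ p = 1`, `χ p = -1`, `χ p = ±i` or `χ p = exp (2πi · u/v)` and derive the values at prime powers by
`map_pow`.  The identities below turn every such hypothesis into the `exp` form, so that each claimed
value is discharged by `Complex.exp_eq_exp_iff_exists_int` and `ring`.  Elementary; no named facts.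
-/

noncomputable section

namespace Summit.Ventures.WeilGRH

namespace DKCert

/-- The claimed value in `exp` form: `valZ ⟨n, p, e, u, v, …⟩ = exp (2πi · u/v)`. [folklore] -/
theorem valZ_eq_expPhase (n p e : ℕ) (u : ℤ) (v : ℕ) (slo shi sden : ℕ) :
    valZ ⟨n, p, e, u, v, slo, shi, sden⟩ = Complex.exp (2 * Real.pi * Complex.I * ((u : ℂ) / (v : ℂ))) := by
  unfold valZ
  congr 1
  push_cast
  ring

/-- `1 = exp (2πi · 0/1)`. [folklore] -/
theorem one_eq_expPhase : (1 : ℂ) = Complex.exp (2 * Real.pi * Complex.I * (((0 : ℤ) : ℂ) / ((1 : ℕ) : ℂ))) := by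
  simp

/-- `−1 = exp (2πi · 1/2)`. [folklore] -/
theorem neg_one_eq_expPhase :
    (-1 : ℂ) = Complex.exp (2 * Real.pi * Complex.I * (((1 : ℤ) : ℂ) / ((2 : ℕ) : ℂ))) := by
  have h : 2 * (Real.pi : ℂ) * Complex.I * (((1 : ℤ) : ℂ) / ((2 : ℕ) : ℂ)) = Real.pi * Complex.I := by
    push_cast; ring
  rw [h, Complex.exp_pi_mul_I]

/-- `i = exp (2πi · 1/4)`. [folklore] -/
theorem I_eq_expPhase :
    Complex.I = Complex.exp (2 * Real.pi * Complex.I * (((1 : ℤ) : ℂ) / ((4 : ℕ) : ℂ))) := by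
  have h : 2 * (Real.pi : ℂ) * Complex.I * (((1 : ℤ) : ℂ) / ((4 : ℕ) : ℂ)) = ((Real.pi / 2 : ℝ) : ℂ) * Complex.I := by
    push_cast; ring
  rw [h, Complex.exp_mul_I, ← Complex.ofReal_cos, ← Complex.ofReal_sin, Real.cos_pi_div_two,
    Real.sin_pi_div_two]
  simp

/-- `−i = exp (2πi · (−1)/4)`. [folklore] -/
theorem neg_I_eq_expPhase :
    -Complex.I = Complex.exp (2 * Real.pi * Complex.I * (((-1 : ℤ) : ℂ) / ((4 : ℕ) : ℂ))) := by
  have h : 2 * (Real.pi : ℂ) * Complex.I * (((-1 : ℤ) : ℂ) / ((4 : ℕ) : ℂ)) = ((-(Real.pi / 2) : ℝ) : ℂ) * Complex.I := by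
    push_cast; ring
  rw [h, Complex.exp_mul_I, ← Complex.ofReal_cos, ← Complex.ofReal_sin, Real.cos_neg, Real.sin_neg,
    Real.cos_pi_div_two, Real.sin_pi_div_two]
  simp

end DKCert

end Summit.Ventures.WeilGRH

end
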